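import Literature.AlgebraicGeometry.Morphisms.CechH1Refinement
import HarnessLib

/-!
# Čech Leray gluing in degree one: classes on the pieces of an open family glue when `Ž² = B̌²` there

[OURS · L1 W4.4 · support for the kill test `SurfaceTermination` stmt-ResolutionOfSingularities-16488, piece U2d of
res-D-pv-045's programme `stub_pgNonincreasing` (PG-LERAY-NOTE §1 (L1)); cut by res-L0-w44-plan-1 RULING (ρ11)
2026-08-27.] Fact-free cochain algebra over the Čech vocabulary of `Morphisms/CechH1` and `Morphisms/CechH1Refinement`;
NOT a statement of any manuscript under review. AI-written; AI review is weaker than expert review.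

Setting: a scheme `f : X → Spec A` over a ring `A`, a family of opens `V : α → X.Opens` (the pieces; not assumed affine,
not assumed to cover), a family `U : ι → X.Opens` COVERING `X` (`⨆ i, U i = ⊤`) that refines `V` along `r : ι → α`
(`U i ≤ V (r i)`). Hypothesis (H2V): every Čech `2`-cocycle of `𝒪_X` on the family `V` (full ordered complex, values in
`Γ(X, V_a ∩ V_b ∩ V_c)`) is a Čech `2`-coboundary. Conclusion (`cechH1_glue_of_cechZ2_family_exact`, with (H2V) as the explicit hypothesis `hH2`): every family of
classes `c_a ∈ Ȟ¹((U_i ∩ V_a)_i, 𝒪_X)` which agree after restriction to `Ȟ¹((U_i ∩ V_a ∩ V_b)_i, 𝒪_X)` for all `a, b` is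
the family of restrictions of ONE class `c̄ ∈ Ȟ¹(𝒰, 𝒪_X)`. This is the low-degree Leray statement «`H¹(X, 𝒪_X) →
H⁰(R¹)` is onto when `H² = 0` downstairs» in Čech form with no higher direct image object (Görtz–Wedhorn II, Cor. 21.82
context; The Stacks Project, Tag 03F7; the bicomplex argument of Serre FAC n° 29).

Proof (§2): representatives `z_a`; `z_a − z_b = d⁰ h_{ab}` on `(U_i ∩ V_{ab})_i`; `δ_V h` is a Čech `0`-cocycle on
`(U_i ∩ V_{abc})_i`, hence (gluing, `U` covers) a section `G_{abc} ∈ Γ(V_{abc})`; `δ_V G = 0` (locality); (H2V) gives `F` with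
`δ_V F = G`; `h' := h − F|` satisfies `δ_V h' = 0` and still `z_a − z_b = d⁰ h'_{ab}`; the cochain
`z̄_{ij} := z_{r i, ij} − h'_{r i, r j; j}` on `U_i ∩ U_j` is a `1`-cocycle on `𝒰` and `z̄|_{(U_i ∩ V_a)_i} − z_a = d⁰ (h'_{r·, a})`.

## References
* U. Görtz, T. Wedhorn, *Algebraic Geometry II*, Springer Spektrum (2023), Cor. 21.82 and (21.16). [GortzWedhorn2023]
* The Stacks Project, Tag 03F7, Tag 01ED. [StacksProject]
* J.-P. Serre, *Faisceaux algébriques cohérents*, Ann. of Math. 61 (1955), n° 29.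
-/

noncomputable section

open CategoryTheory AlgebraicGeometry Limits TopologicalSpace Opposite

universe u v w

namespace Literature.AlgebraicGeometry.Morphisms

variable {A : Type u} [CommRing A] {X : Scheme.{u}} (f : X ⟶ Spec (.of A))

/-! ## §0. Čech `3`-cochains and `d²` of the structure sheaf on a family of opens -/

section DegreeTwo

variable {α : Type w} (V : α → X.Opens)

/-- Čech `3`-cochains `Č³(𝒱, 𝒪_X) = Π_{a,b,c,d} Γ(X, V_a ∩ V_b ∩ V_c ∩ V_d)` (all ordered quadruples).
[cite: StacksProject, Tag 01ED (Cohomology, Section 20.9)] -/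
abbrev CechC3 : Type (max u w) := (a b c d : α) → Sections f (V a ⊓ V b ⊓ V c ⊓ V d)

/-- The Čech differential `d² : Č² → Č³`,
`(d² g)_{abcd} = g_{bcd} - g_{acd} + g_{abd} - g_{abc}` (all restricted to `V_{abcd}`).
[cite: StacksProject, Tag 01ED (Cohomology, Section 20.9)] -/
def cechD2 : CechC2 f V →ₗ[A] CechC3 f V where
  toFun g a b c d :=
    Sections.res f (le_inf (le_inf (inf_le_left.trans (inf_le_left.trans inf_le_right))
        (inf_le_left.trans inf_le_right)) inf_le_right) (g b c d) -
      Sections.res f (le_inf (le_inf (inf_le_left.trans (inf_le_left.trans inf_le_left))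
        (inf_le_left.trans inf_le_right)) inf_le_right) (g a c d) +
      Sections.res f (le_inf (inf_le_left.trans inf_le_left) inf_le_right) (g a b d) -
      Sections.res f inf_le_left (g a b c)
  map_add' g g' := by ext a b c d; simp only [Pi.add_apply, map_add]; abel
  map_smul' s g := by
    ext a b c d; simp only [Pi.smul_apply, map_smul, RingHom.id_apply, smul_sub, smul_add]

/-- Unfolding of `cechD2` (the Čech differential in degree `2`). [cite: StacksProject, Tag 01ED (Cohomology, Section 20.9)] -/
theorem cechD2_apply (g : CechC2 f V) (a b c d : α) :
    cechD2 f V g a b c d =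
      Sections.res f (le_inf (le_inf (inf_le_left.trans (inf_le_left.trans inf_le_right))
          (inf_le_left.trans inf_le_right)) inf_le_right) (g b c d) -
        Sections.res f (le_inf (le_inf (inf_le_left.trans (inf_le_left.trans inf_le_left))
          (inf_le_left.trans inf_le_right)) inf_le_right) (g a c d) +
        Sections.res f (le_inf (inf_le_left.trans inf_le_left) inf_le_right) (g a b d) -
        Sections.res f inf_le_left (g a b c) :=
  rfl

/-- `d² ∘ d¹ = 0`. [cite: StacksProject, Tag 01ED (Cohomology, Section 20.9)] -/
theorem cechD2_cechD1 (h : CechC1 f V) : cechD2 f V (cechD1 f V h) = 0 := by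
  ext a b c d
  simp only [cechD2_apply, cechD1_apply, map_sub, map_add, Sections.res_res, Pi.zero_apply]
  have e := fun (x y : α) (hx : V a ⊓ V b ⊓ V c ⊓ V d ≤ V x) (hy : V a ⊓ V b ⊓ V c ⊓ V d ≤ V y)
    (p q : V a ⊓ V b ⊓ V c ⊓ V d ≤ V x ⊓ V y) => Sections.res_eq_res f p q (h x y)
  have ha : V a ⊓ V b ⊓ V c ⊓ V d ≤ V a := inf_le_left.trans (inf_le_left.trans inf_le_left)
  have hb : V a ⊓ V b ⊓ V c ⊓ V d ≤ V b := inf_le_left.trans (inf_le_left.trans inf_le_right)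
  have hc : V a ⊓ V b ⊓ V c ⊓ V d ≤ V c := inf_le_left.trans inf_le_right
  have hd : V a ⊓ V b ⊓ V c ⊓ V d ≤ V d := inf_le_right
  rw [e c d hc hd _ (le_inf hc hd), e b d hb hd _ (le_inf hb hd), e b c hb hc _ (le_inf hb hc),
    e a d ha hd _ (le_inf ha hd), e a c ha hc _ (le_inf ha hc), e a b ha hb _ (le_inf ha hb)]
  abel

end DegreeTwo

/-! ## §2. The gluing theorem -/

section Glue

variable {ι : Type v} {α : Type w} (U : ι → X.Opens) (V : α → X.Opens)

/-- **Čech Leray gluing in degree one.** Let `U` cover `X` and refine `V` along `r`, and assume (H2V) `Ž² = B̌²` for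
`𝒪_X` on the family `V`. Then every family of classes `c_a ∈ Ȟ¹((U_i ∩ V_a)_i, 𝒪_X)` that agree in
`Ȟ¹((U_i ∩ V_a ∩ V_b)_i, 𝒪_X)` for all `a, b` comes from ONE class `c̄ ∈ Ȟ¹(𝒰, 𝒪_X)` by restriction.
[cite: GortzWedhorn2023, Cor. 21.82 (p. 265)] -/
theorem cechH1_glue_of_cechZ2_family_exact (r : ι → α) (hr : ∀ i, U i ≤ V (r i)) (hU : ⨆ i, U i = ⊤)
    (hH2 : ∀ g : CechC2 f V, cechD2 f V g = 0 → ∃ h : CechC1 f V, cechD1 f V h = g)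
    (c : ∀ a, CechH1 f (fun i => U i ⊓ V a))
    (hc : ∀ a b,
      cechRefineH1 f (fun i => U i ⊓ V a) (fun i => U i ⊓ V a ⊓ V b) id (fun _ => inf_le_left) (c a) =
        cechRefineH1 f (fun i => U i ⊓ V b) (fun i => U i ⊓ V a ⊓ V b) id
          (fun _ => le_inf (inf_le_left.trans inf_le_left) inf_le_right) (c b)) :
    ∃ cbar : CechH1 f U,
      ∀ a, cechRefineH1 f U (fun i => U i ⊓ V a) id (fun _ => inf_le_left) cbar = c a := by
  classical
  -- Step 0: cocycle representatives `z a` of the classes `c a`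
  choose z hz using fun a => CechH1.mk_surjective f (fun i => U i ⊓ V a) (c a)
  -- Step 1: `h a b` with `d⁰ (h a b) = ρ z_a - ρ z_b` on the family `(U_i ∩ V_a ∩ V_b)_i`
  have hdiff : ∀ a b,
      cechRefineC1 f (fun i => U i ⊓ V a) (fun i => U i ⊓ V a ⊓ V b) id (fun _ => inf_le_left)
          (z a : CechC1 f (fun k => U k ⊓ V a)) -
        cechRefineC1 f (fun i => U i ⊓ V b) (fun i => U i ⊓ V a ⊓ V b) id
          (fun _ => le_inf (inf_le_left.trans inf_le_left) inf_le_right) (z b : CechC1 f (fun k => U k ⊓ V b)) ∈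
        cechB1 f (fun i => U i ⊓ V a ⊓ V b) := by
    intro a b
    have e := hc a b
    rw [← hz a, ← hz b, cechRefineH1_mk, cechRefineH1_mk, CechH1.mk_eq_mk_iff, cechRefineZ1_coe,
      cechRefineZ1_coe] at e
    exact e
  choose h hh using fun a b => (mem_cechB1_iff f _ _).mp (hdiff a b)
  -- componentwise, restricted to any `W ⊆ U_i ∩ U_j ∩ V_a ∩ V_b`
  have hh' : ∀ a b i j,
      Sections.res f (inf_le_right : (U i ⊓ V a ⊓ V b) ⊓ (U j ⊓ V a ⊓ V b) ≤ _) (h a b j) -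
          Sections.res f (inf_le_left : (U i ⊓ V a ⊓ V b) ⊓ (U j ⊓ V a ⊓ V b) ≤ _) (h a b i) =
        Sections.res f (inf_le_inf inf_le_left inf_le_left :
            (U i ⊓ V a ⊓ V b) ⊓ (U j ⊓ V a ⊓ V b) ≤ (U i ⊓ V a) ⊓ (U j ⊓ V a))
            ((z a : CechC1 f (fun k => U k ⊓ V a)) i j) -
          Sections.res f (inf_le_inf (le_inf (inf_le_left.trans inf_le_left) inf_le_right)
              (le_inf (inf_le_left.trans inf_le_left) inf_le_right) :
            (U i ⊓ V a ⊓ V b) ⊓ (U j ⊓ V a ⊓ V b) ≤ (U i ⊓ V b) ⊓ (U j ⊓ V b))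
            ((z b : CechC1 f (fun k => U k ⊓ V b)) i j) := by
    intro a b i j
    have e := congrFun (congrFun (hh a b) i) j
    rw [cechD0_apply, Pi.sub_apply, Pi.sub_apply, cechRefineC1_apply, cechRefineC1_apply] at e
    exact e
  -- componentwise, restricted to any `W ⊆ U_i ∩ U_j ∩ V_a ∩ V_b`
  have P1h : ∀ a b i j (W : X.Opens) (hi : W ≤ U i) (hj : W ≤ U j) (ha : W ≤ V a) (hb : W ≤ V b),
      Sections.res f (le_inf (le_inf hj ha) hb) (h a b j) -
          Sections.res f (le_inf (le_inf hi ha) hb) (h a b i) =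
        Sections.res f (le_inf (le_inf hi ha) (le_inf hj ha)) ((z a : CechC1 f (fun k => U k ⊓ V a)) i j) -
          Sections.res f (le_inf (le_inf hi hb) (le_inf hj hb)) ((z b : CechC1 f (fun k => U k ⊓ V b)) i j) := by
    intro a b i j W hi hj ha hb
    have e' := congrArg (Sections.res f (le_inf (le_inf (le_inf hi ha) hb) (le_inf (le_inf hj ha) hb) :
      W ≤ (U i ⊓ V a ⊓ V b) ⊓ (U j ⊓ V a ⊓ V b))) (hh' a b i j)
    rw [map_sub, map_sub, Sections.res_res, Sections.res_res, Sections.res_res, Sections.res_res] at e'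
    exact e'
  -- the cocycle identities of the `z a`, restricted
  have ZC : ∀ a i j k (W : X.Opens) (hi : W ≤ U i) (hj : W ≤ U j) (hk : W ≤ U k) (ha : W ≤ V a),
      Sections.res f (le_inf (le_inf hj ha) (le_inf hk ha)) ((z a : CechC1 f (fun k => U k ⊓ V a)) j k) -
          Sections.res f (le_inf (le_inf hi ha) (le_inf hk ha)) ((z a : CechC1 f (fun k => U k ⊓ V a)) i k) +
        Sections.res f (le_inf (le_inf hi ha) (le_inf hj ha)) ((z a : CechC1 f (fun k => U k ⊓ V a)) i j) = 0 :=
    fun a i j k W hi hj hk ha =>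
      cechZ1.cocycle_res f (fun i => U i ⊓ V a) (z a).2 i j k (le_inf hi ha) (le_inf hj ha) (le_inf hk ha)
  -- Step 2: `g a b c i = (δ_V h)_{abc}` on `U_i ∩ V_{abc}` is a Čech `0`-cocycle over `V_{abc}`; glue to `G a b c`
  have hcov3 : ∀ a b c, V a ⊓ V b ⊓ V c ≤ ⨆ i, U i ⊓ (V a ⊓ V b ⊓ V c) := fun a b c => by
    rw [← iSup_inf_eq, hU, top_inf_eq]
  set g : ∀ a b c, (i : ι) → Sections f (U i ⊓ (V a ⊓ V b ⊓ V c)) := fun a b c i =>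
    Sections.res f (le_inf (le_inf inf_le_left (inf_le_right.trans (inf_le_left.trans inf_le_right)))
        (inf_le_right.trans inf_le_right) : _ ≤ U i ⊓ V b ⊓ V c) (h b c i) -
      Sections.res f (le_inf (le_inf inf_le_left (inf_le_right.trans (inf_le_left.trans inf_le_left)))
        (inf_le_right.trans inf_le_right) : _ ≤ U i ⊓ V a ⊓ V c) (h a c i) +
      Sections.res f (le_inf (le_inf inf_le_left (inf_le_right.trans (inf_le_left.trans inf_le_left)))
        (inf_le_right.trans (inf_le_left.trans inf_le_right)) : _ ≤ U i ⊓ V a ⊓ V b) (h a b i) with hgdef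
  -- `g a b c i` restricted to any `W`
  have gres : ∀ a b c i (W : X.Opens) (hi : W ≤ U i) (ha : W ≤ V a) (hb : W ≤ V b) (hc : W ≤ V c),
      Sections.res f (le_inf hi (le_inf (le_inf ha hb) hc)) (g a b c i) =
        Sections.res f (le_inf (le_inf hi hb) hc) (h b c i) - Sections.res f (le_inf (le_inf hi ha) hc) (h a c i) +
          Sections.res f (le_inf (le_inf hi ha) hb) (h a b i) := by
    intro a b c i W hi ha hb hc
    simp only [hgdef, map_sub, map_add, Sections.res_res]
  have hs : ∀ a b c i j,
      Sections.res f (inf_le_left : (U i ⊓ (V a ⊓ V b ⊓ V c)) ⊓ (U j ⊓ (V a ⊓ V b ⊓ V c)) ≤ _) (g a b c i) =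
        Sections.res f (inf_le_right : (U i ⊓ (V a ⊓ V b ⊓ V c)) ⊓ (U j ⊓ (V a ⊓ V b ⊓ V c)) ≤ _)
          (g a b c j) := by
    intro a b c i j
    have hWi : (U i ⊓ (V a ⊓ V b ⊓ V c)) ⊓ (U j ⊓ (V a ⊓ V b ⊓ V c)) ≤ U i := inf_le_left.trans inf_le_left
    have hWj : (U i ⊓ (V a ⊓ V b ⊓ V c)) ⊓ (U j ⊓ (V a ⊓ V b ⊓ V c)) ≤ U j := inf_le_right.trans inf_le_left
    have hWa : (U i ⊓ (V a ⊓ V b ⊓ V c)) ⊓ (U j ⊓ (V a ⊓ V b ⊓ V c)) ≤ V a :=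
      inf_le_left.trans (inf_le_right.trans (inf_le_left.trans inf_le_left))
    have hWb : (U i ⊓ (V a ⊓ V b ⊓ V c)) ⊓ (U j ⊓ (V a ⊓ V b ⊓ V c)) ≤ V b :=
      inf_le_left.trans (inf_le_right.trans (inf_le_left.trans inf_le_right))
    have hWc : (U i ⊓ (V a ⊓ V b ⊓ V c)) ⊓ (U j ⊓ (V a ⊓ V b ⊓ V c)) ≤ V c :=
      inf_le_left.trans (inf_le_right.trans inf_le_right)
    have Gi := gres a b c i _ hWi hWa hWb hWc
    have Gj := gres a b c j _ hWj hWa hWb hWc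
    have Ebc := P1h b c i j _ hWi hWj hWb hWc
    have Eac := P1h a c i j _ hWi hWj hWa hWc
    have Eab := P1h a b i j _ hWi hWj hWa hWb
    rw [Sections.res_eq_res f _ (le_inf hWi (le_inf (le_inf hWa hWb) hWc)) (g a b c i),
      Sections.res_eq_res f _ (le_inf hWj (le_inf (le_inf hWa hWb) hWc)) (g a b c j), Gi, Gj]
    linear_combination -Ebc + Eac - Eab
  choose G hG using fun a b c =>
    Sections.exists_res_eq f (fun i => U i ⊓ (V a ⊓ V b ⊓ V c)) (fun i => inf_le_right) (hcov3 a b c)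
      (g a b c) (hs a b c)
  -- `G a b c` restricted to any `W ⊆ U_i ∩ V_{abc}`
  have Gres : ∀ a b c i (W : X.Opens) (hi : W ≤ U i) (ha : W ≤ V a) (hb : W ≤ V b) (hc : W ≤ V c),
      Sections.res f (le_inf (le_inf ha hb) hc) (G a b c) =
        Sections.res f (le_inf (le_inf hi hb) hc) (h b c i) - Sections.res f (le_inf (le_inf hi ha) hc) (h a c i) +
          Sections.res f (le_inf (le_inf hi ha) hb) (h a b i) := by
    intro a b c i W hi ha hb hc
    have e := congrArg (Sections.res f (le_inf hi (le_inf (le_inf ha hb) hc) : W ≤ U i ⊓ (V a ⊓ V b ⊓ V c)))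
      (hG a b c i)
    rw [Sections.res_res] at e
    rw [Sections.res_eq_res f _ ((le_inf hi (le_inf (le_inf ha hb) hc) : W ≤ U i ⊓ (V a ⊓ V b ⊓ V c)).trans
      inf_le_right) (G a b c), e]
    exact gres a b c i W hi ha hb hc
  -- Step 3: `δ_V G = 0` (checked locally on the `U_i`)
  have hD2 : cechD2 f V G = 0 := by
    funext a b c d
    rw [cechD2_apply]
    change _ = (0 : Sections f _)
    have hcov4 : V a ⊓ V b ⊓ V c ⊓ V d ≤ ⨆ i, U i ⊓ (V a ⊓ V b ⊓ V c ⊓ V d) := by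
      rw [← iSup_inf_eq, hU, top_inf_eq]
    apply Sections.eq_of_res_eq f (fun i => U i ⊓ (V a ⊓ V b ⊓ V c ⊓ V d)) (fun i => inf_le_right) hcov4
    intro i
    have hi : U i ⊓ (V a ⊓ V b ⊓ V c ⊓ V d) ≤ U i := inf_le_left
    have ha : U i ⊓ (V a ⊓ V b ⊓ V c ⊓ V d) ≤ V a :=
      inf_le_right.trans (inf_le_left.trans (inf_le_left.trans inf_le_left))
    have hb : U i ⊓ (V a ⊓ V b ⊓ V c ⊓ V d) ≤ V b :=
      inf_le_right.trans (inf_le_left.trans (inf_le_left.trans inf_le_right))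
    have hc' : U i ⊓ (V a ⊓ V b ⊓ V c ⊓ V d) ≤ V c := inf_le_right.trans (inf_le_left.trans inf_le_right)
    have hd : U i ⊓ (V a ⊓ V b ⊓ V c ⊓ V d) ≤ V d := inf_le_right.trans inf_le_right
    have H1 := Gres b c d i _ hi hb hc' hd
    have H2 := Gres a c d i _ hi ha hc' hd
    have H3 := Gres a b d i _ hi ha hb hd
    have H4 := Gres a b c i _ hi ha hb hc'
    rw [map_zero, map_sub, map_add, map_sub, Sections.res_res, Sections.res_res, Sections.res_res,
      Sections.res_res]
    rw [Sections.res_eq_res f _ (le_inf (le_inf hb hc') hd) (G b c d),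
      Sections.res_eq_res f _ (le_inf (le_inf ha hc') hd) (G a c d),
      Sections.res_eq_res f _ (le_inf (le_inf ha hb) hd) (G a b d),
      Sections.res_eq_res f _ (le_inf (le_inf ha hb) hc') (G a b c), H1, H2, H3, H4]
    ring
  -- Step 4: (H2V) gives `F` with `δ_V F = G`; the corrected `h' = h - F|` is a `V`-cocycle on each `U_i`
  obtain ⟨F, hF⟩ := hH2 G hD2
  set h' : ∀ a b, (i : ι) → Sections f (U i ⊓ V a ⊓ V b) := fun a b i =>
    h a b i - Sections.res f (le_inf (inf_le_left.trans inf_le_right) inf_le_right : _ ≤ V a ⊓ V b) (F a b)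
    with hh'def
  have h'res : ∀ a b i (W : X.Opens) (hi : W ≤ U i) (ha : W ≤ V a) (hb : W ≤ V b),
      Sections.res f (le_inf (le_inf hi ha) hb) (h' a b i) =
        Sections.res f (le_inf (le_inf hi ha) hb) (h a b i) - Sections.res f (le_inf ha hb) (F a b) := by
    intro a b i W hi ha hb
    simp only [hh'def, map_sub, Sections.res_res]
  -- (P1) `h' a b j - h' a b i = z_a ij - z_b ij` on `W ⊆ U_i ∩ U_j ∩ V_a ∩ V_b`
  have P1 : ∀ a b i j (W : X.Opens) (hi : W ≤ U i) (hj : W ≤ U j) (ha : W ≤ V a) (hb : W ≤ V b),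
      Sections.res f (le_inf (le_inf hj ha) hb) (h' a b j) -
          Sections.res f (le_inf (le_inf hi ha) hb) (h' a b i) =
        Sections.res f (le_inf (le_inf hi ha) (le_inf hj ha)) ((z a : CechC1 f (fun k => U k ⊓ V a)) i j) -
          Sections.res f (le_inf (le_inf hi hb) (le_inf hj hb)) ((z b : CechC1 f (fun k => U k ⊓ V b)) i j) := by
    intro a b i j W hi hj ha hb
    rw [h'res a b j W hj ha hb, h'res a b i W hi ha hb, ← P1h a b i j W hi hj ha hb]
    ring
  -- (P2) `δ_V h' = 0` on `W ⊆ U_i ∩ V_{abc}`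
  have P2 : ∀ a b c i (W : X.Opens) (hi : W ≤ U i) (ha : W ≤ V a) (hb : W ≤ V b) (hc : W ≤ V c),
      Sections.res f (le_inf (le_inf hi hb) hc) (h' b c i) - Sections.res f (le_inf (le_inf hi ha) hc) (h' a c i) +
          Sections.res f (le_inf (le_inf hi ha) hb) (h' a b i) = 0 := by
    intro a b c i W hi ha hb hc
    have e := congrFun (congrFun (congrFun hF a) b) c
    rw [cechD1_apply] at e
    have e' := congrArg (Sections.res f (le_inf (le_inf ha hb) hc : W ≤ V a ⊓ V b ⊓ V c)) e
    rw [map_add, map_sub, Sections.res_res, Sections.res_res, Sections.res_res, Gres a b c i W hi ha hb hc] at e'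
    rw [h'res b c i W hi hb hc, h'res a c i W hi ha hc, h'res a b i W hi ha hb]
    rw [Sections.res_eq_res f _ (le_inf hb hc) (F b c), Sections.res_eq_res f _ (le_inf ha hc) (F a c),
      Sections.res_eq_res f _ (le_inf ha hb) (F a b)] at e'
    linear_combination -e'
  -- consequences: `h' a a = 0` and antisymmetry
  have P2diag : ∀ a i (W : X.Opens) (hi : W ≤ U i) (ha : W ≤ V a),
      Sections.res f (le_inf (le_inf hi ha) ha) (h' a a i) = 0 := by
    intro a i W hi ha
    have e := P2 a a a i W hi ha ha ha
    linear_combination e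
  have P2anti : ∀ a b i (W : X.Opens) (hi : W ≤ U i) (ha : W ≤ V a) (hb : W ≤ V b),
      Sections.res f (le_inf (le_inf hi hb) ha) (h' b a i) = - Sections.res f (le_inf (le_inf hi ha) hb) (h' a b i) := by
    intro a b i W hi ha hb
    have e := P2 a b a i W hi ha hb ha
    have d := P2diag a i W hi ha
    linear_combination e + d
  -- Step 5: the glued cocycle on `𝒰`
  set zbar : CechC1 f U := fun i j =>
    Sections.res f (le_inf (le_inf inf_le_left (inf_le_left.trans (hr i))) (le_inf inf_le_right (inf_le_left.trans (hr i))) :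
        U i ⊓ U j ≤ (U i ⊓ V (r i)) ⊓ (U j ⊓ V (r i))) ((z (r i) : CechC1 f (fun k => U k ⊓ V (r i))) i j) -
      Sections.res f (le_inf (le_inf inf_le_right (inf_le_left.trans (hr i))) (inf_le_right.trans (hr j)) :
        U i ⊓ U j ≤ U j ⊓ V (r i) ⊓ V (r j)) (h' (r i) (r j) j) with hzbar
  have zbar_res : ∀ i j (W : X.Opens) (hi : W ≤ U i) (hj : W ≤ U j),
      Sections.res f (le_inf hi hj) (zbar i j) =
        Sections.res f (le_inf (le_inf hi (hi.trans (hr i))) (le_inf hj (hi.trans (hr i)))) ((z (r i) : CechC1 f (fun k => U k ⊓ V (r i))) i j) -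
          Sections.res f (le_inf (le_inf hj (hi.trans (hr i))) (hj.trans (hr j))) (h' (r i) (r j) j) := by
    intro i j W hi hj
    simp only [hzbar, map_sub, Sections.res_res]
  have zbarZ : zbar ∈ cechZ1 f U := by
    rw [mem_cechZ1_iff]
    funext i j k
    rw [cechD1_apply]
    change _ = (0 : Sections f _)
    have hi : U i ⊓ U j ⊓ U k ≤ U i := inf_le_left.trans inf_le_left
    have hj : U i ⊓ U j ⊓ U k ≤ U j := inf_le_left.trans inf_le_right
    have hk : U i ⊓ U j ⊓ U k ≤ U k := inf_le_right
    have Zjk := zbar_res j k _ hj hk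
    have Zik := zbar_res i k _ hi hk
    have Zij := zbar_res i j _ hi hj
    rw [Sections.res_eq_res f _ (le_inf hj hk) (zbar j k), Sections.res_eq_res f _ (le_inf hi hk) (zbar i k),
      Sections.res_eq_res f _ (le_inf hi hj) (zbar i j), Zjk, Zik, Zij]
    have hri : U i ⊓ U j ⊓ U k ≤ V (r i) := hi.trans (hr i)
    have hrj : U i ⊓ U j ⊓ U k ≤ V (r j) := hj.trans (hr j)
    have hrk : U i ⊓ U j ⊓ U k ≤ V (r k) := hk.trans (hr k)
    -- (a) pass from `z (r j)` to `z (r i)` on `(j,k)`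
    have A := P1 (r j) (r i) j k _ hj hk hrj hri
    -- (b) cocycle identity of `z (r i)` on `(i,j,k)`
    have B := ZC (r i) i j k _ hi hj hk hri
    -- (c) cocycle identity of `h'` at `(r i, r j, r k)`, index `k`
    have C := P2 (r i) (r j) (r k) k _ hk hri hrj hrk
    -- (d) antisymmetry at indices `k` and `j`
    have Dk := P2anti (r i) (r j) k _ hk hri hrj
    have Dj := P2anti (r i) (r j) j _ hj hri hrj
    linear_combination -A + B - C + Dk - Dj
  -- Step 6: restriction to the pieces
  refine ⟨CechH1.mk f U ⟨zbar, zbarZ⟩, fun a => ?_⟩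
  rw [← hz a, cechRefineH1_mk, CechH1.mk_eq_mk_iff, cechRefineZ1_coe, mem_cechB1_iff]
  set kk : CechC0 f (fun k => U k ⊓ V a) := fun i =>
    Sections.res f (le_inf (le_inf inf_le_left (inf_le_left.trans (hr i))) inf_le_right :
      U i ⊓ V a ≤ U i ⊓ V (r i) ⊓ V a) (h' (r i) a i) with hkk
  refine ⟨kk, ?_⟩
  funext i j
  change Sections.res f (inf_le_right : (U i ⊓ V a) ⊓ (U j ⊓ V a) ≤ U j ⊓ V a) (kk j) -
      Sections.res f (inf_le_left : (U i ⊓ V a) ⊓ (U j ⊓ V a) ≤ U i ⊓ V a) (kk i) =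
    Sections.res f (inf_le_inf inf_le_left inf_le_left : (U i ⊓ V a) ⊓ (U j ⊓ V a) ≤ U i ⊓ U j) (zbar i j) -
      (z a : CechC1 f (fun k => U k ⊓ V a)) i j
  have hi : (U i ⊓ V a) ⊓ (U j ⊓ V a) ≤ U i := inf_le_left.trans inf_le_left
  have hj : (U i ⊓ V a) ⊓ (U j ⊓ V a) ≤ U j := inf_le_right.trans inf_le_left
  have ha : (U i ⊓ V a) ⊓ (U j ⊓ V a) ≤ V a := inf_le_left.trans inf_le_right
  have hri : (U i ⊓ V a) ⊓ (U j ⊓ V a) ≤ V (r i) := hi.trans (hr i)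
  have hrj : (U i ⊓ V a) ⊓ (U j ⊓ V a) ≤ V (r j) := hj.trans (hr j)
  have Zij := zbar_res i j _ hi hj
  simp only [hkk, Sections.res_res]
  rw [Sections.res_eq_res f _ (le_inf hi hj) (zbar i j), Zij,
    Sections.res_eq_res f _ (le_inf (le_inf hj hrj) ha) (h' (r j) a j),
    Sections.res_eq_res f _ (le_inf (le_inf hi hri) ha) (h' (r i) a i)]
  have Za : (z a : CechC1 f (fun k => U k ⊓ V a)) i j =
      Sections.res f (le_inf (le_inf hi ha) (le_inf hj ha)) ((z a : CechC1 f (fun k => U k ⊓ V a)) i j) := by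
    rw [Sections.res_eq_res f _ (le_refl _) ((z a : CechC1 f (fun k => U k ⊓ V a)) i j), Sections.res_self]
  rw [Za]
  have A := P1 (r i) a i j _ hi hj hri ha
  have C := P2 (r i) (r j) a j _ hj hri hrj ha
  linear_combination A + C

end Glue

end Literature.AlgebraicGeometry.Morphisms

end
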